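import Mathlib.RingTheory.KrullDimension.Polynomial
import Mathlib.RingTheory.Polynomial.Quotient
import Literature.ModelTheory.Zilber.EACPeriodicReduction
import HarnessLib

/-!
# Cylinders over the last coordinate drop the dimension by exactly one

Zilber's Exponential-Algebraic Closedness, case ladder (host summit Schanuel, cell `pub-schanuel`,
seat 2, gen 5).  Algebraic input for the `d = 2` bridge of the fibration principle to
Mantova–Masser's density question (`ZilberEacFibrationMM.lean`): in the normalised periodic piece the
base `B = π(W ∩ Gⁿ) ⊆ F^{d+1}` has period `e_last` (`IsPeriodVec F B (Pi.single (Fin.last d) 1)`,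
seat 1's `ECCellPeriodicStd`), i.e. its closure is a cylinder over the last coordinate
(`mem_zeroLocus_vanishingIdeal_update_last_iff`).  Then:

* `rename_coeff_mem_vanishingIdeal_of_isPeriodVec`: every `x_last`-coefficient of a polynomial of
  `I(B)` (read in `F[x'][x_last]`) lies in `I(B)`;
* `map_vanishingIdeal_eq_map_C`: `I(B)`, transported to `F[x'][x_last]`, is the extension of
  `J = I(B) ∩ F[x']`;
* `ringKrullDim_quotient_eq_of_isPeriodVec`: `dim F[x]/I(B) = dim F[x']/J + 1` (Mathlib:
  `(R ⧸ J)[X] ≃ R[X] ⧸ J·R[X]` and `dim A[X] = dim A + 1` for Noetherian `A`).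

Honest framing: folklore commutative algebra; nothing about `EC(3,2)` (OPEN) or Schanuel's
conjecture is asserted here.
-/

noncomputable section

open MvPolynomial
open Literature.NumberTheory.Transcendental Literature.ModelTheory.Zilber

set_option linter.dupNamespace false

namespace Summit.Schanuel.Schanuel.Theorems

variable {F : Type*} [Field F] {d : ℕ}

/-! ## The identification `F[x', x_last] ≅ F[x'][X]` -/

/-- Evaluation through `F[X_{Fin (d+1)}] ≅ F[X_{Fin d}][X]` (`x_last ↦ X`, `x_i ↦ C X_i`):
`H(x', t) = (Φ H)^{x'}(t)`. [folklore] -/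
theorem eval_snoc_eq_eval_map (x' : Fin d → F) (t : F) (H : MvPolynomial (Fin (d + 1)) F) :
    MvPolynomial.eval (Fin.snoc x' t : Fin (d + 1) → F) H =
      ((MvPolynomial.optionEquivLeft F (Fin d) (rename finSuccEquivLast H)).map
        (MvPolynomial.eval x')).eval t := by
  have hfun : (Fin.snoc x' t : Fin (d + 1) → F) = (fun o : Option (Fin d) => o.elim t x') ∘ finSuccEquivLast := by
    funext k
    rcases Fin.eq_castSucc_or_eq_last k with ⟨i, rfl⟩ | rfl
    · rw [Fin.snoc_castSucc, Function.comp_apply, finSuccEquivLast_castSucc, Option.elim_some]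
    · rw [Fin.snoc_last, Function.comp_apply, finSuccEquivLast_last, Option.elim_none]
  rw [hfun, ← MvPolynomial.eval_rename, MvPolynomial.optionEquivLeft_elim_eval]

/-- The transport maps `rename castSucc c` (a polynomial in `x'` alone) to the constant `C c`.
[folklore] -/
theorem optionEquivLeft_rename_rename_castSucc (c : MvPolynomial (Fin d) F) :
    MvPolynomial.optionEquivLeft F (Fin d) (rename finSuccEquivLast (rename Fin.castSucc c)) =
      Polynomial.C c := by
  rw [MvPolynomial.rename_rename]
  have h : (finSuccEquivLast ∘ Fin.castSucc : Fin d → Option (Fin d)) = some := by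
    funext i
    exact finSuccEquivLast_castSucc i
  rw [h]
  induction c using MvPolynomial.induction_on with
  | C a => rw [MvPolynomial.rename_C, MvPolynomial.optionEquivLeft_C, Polynomial.C_inj]
  | add p q hp hq => rw [map_add, map_add, hp, hq, ← Polynomial.C_add]
  | mul_X p i hp =>
    rw [map_mul, map_mul, hp, MvPolynomial.rename_X, MvPolynomial.optionEquivLeft_X_some,
      ← Polynomial.C_mul]

/-! ## Coefficients of polynomials vanishing on a cylinder -/

section Cylinder

variable [CharZero F] {B : Set (Fin (d + 1) → F)}

/-- **Every `x_last`-coefficient of a polynomial of `I(B)` lies in `I(B)`** when `B` has period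
`e_last` (its closure is a cylinder over the last coordinate, so `t ↦ H(x', t)` vanishes identically
for `x ∈ B`). [folklore] -/
theorem rename_coeff_mem_vanishingIdeal_of_isPeriodVec [Infinite F]
    (hper : IsPeriodVec F B (Pi.single (Fin.last d) 1))
    {H : MvPolynomial (Fin (d + 1)) F} (hH : H ∈ vanishingIdeal F B) (j : ℕ) :
    rename Fin.castSucc ((MvPolynomial.optionEquivLeft F (Fin d) (rename finSuccEquivLast H)).coeff j) ∈
      vanishingIdeal F B := by
  rw [mem_vanishingIdeal_iff]
  intro x hx
  set x' : Fin d → F := fun i => x (Fin.castSucc i) with hx'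
  -- `t ↦ H(x', t)` vanishes identically
  set q : Polynomial F :=
    (MvPolynomial.optionEquivLeft F (Fin d) (rename finSuccEquivLast H)).map (MvPolynomial.eval x')
    with hq
  have hxcl : x ∈ zeroLocus F (vanishingIdeal F B) :=
    le_zeroLocus_iff_le_vanishingIdeal.2 le_rfl hx
  have hroots : ∀ t : F, q.eval t = 0 := by
    intro t
    have hmem := (mem_zeroLocus_vanishingIdeal_update_last_iff hper x t).2 hxcl
    have hupd : Function.update x (Fin.last d) t = (Fin.snoc x' t : Fin (d + 1) → F) := by
      funext k
      rcases Fin.eq_castSucc_or_eq_last k with ⟨i, rfl⟩ | rfl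
      · rw [Function.update_of_ne (Fin.castSucc_ne_last i), Fin.snoc_castSucc]
      · rw [Function.update_self, Fin.snoc_last]
    have := (mem_zeroLocus_iff.1 hmem) H hH
    change MvPolynomial.eval _ H = 0 at this
    rw [hupd, eval_snoc_eq_eval_map] at this
    exact this
  have hq0 : q = 0 :=
    Polynomial.eq_zero_of_infinite_isRoot q (Set.infinite_univ.mono fun t _ => hroots t)
  have hcj : MvPolynomial.eval x'
      ((MvPolynomial.optionEquivLeft F (Fin d) (rename finSuccEquivLast H)).coeff j) = 0 := by
    have := congrArg (fun p => p.coeff j) hq0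
    simpa only [hq, Polynomial.coeff_map, Polynomial.coeff_zero] using this
  change MvPolynomial.eval x (rename Fin.castSucc _) = 0
  rw [MvPolynomial.eval_rename]
  exact hcj

/-- **`I(B)` is extended from `F[x']`**: transported to `F[x'][X]`, the vanishing ideal of a set with
period `e_last` is `J · F[x'][X]` for `J = I(B) ∩ F[x']` (`= comap (rename castSucc) I(B)`).
[folklore] -/
theorem map_vanishingIdeal_eq_map_C [Infinite F] (hper : IsPeriodVec F B (Pi.single (Fin.last d) 1)) :
    (vanishingIdeal F B).map
        (((MvPolynomial.renameEquiv F (finSuccEquivLast (n := d))).trans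
          (MvPolynomial.optionEquivLeft F (Fin d))).toRingEquiv :
            MvPolynomial (Fin (d + 1)) F →+* Polynomial (MvPolynomial (Fin d) F)) =
      Ideal.map (Polynomial.C : MvPolynomial (Fin d) F →+* _)
        ((vanishingIdeal F B).comap (rename (R := F) (Fin.castSucc (n := d)) :
          MvPolynomial (Fin d) F →+* MvPolynomial (Fin (d + 1)) F)) := by
  set Φ := ((MvPolynomial.renameEquiv F (finSuccEquivLast (n := d))).trans
    (MvPolynomial.optionEquivLeft F (Fin d))).toRingEquiv with hΦ
  have hΦapply : ∀ H, Φ H = MvPolynomial.optionEquivLeft F (Fin d) (rename finSuccEquivLast H) :=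
    fun H => rfl
  refine le_antisymm ?_ ?_
  · intro h hh
    rw [Ideal.map_comap_of_equiv, Ideal.mem_comap] at hh
    rw [Ideal.mem_map_C_iff]
    intro j
    rw [Ideal.mem_comap]
    have hh' := rename_coeff_mem_vanishingIdeal_of_isPeriodVec hper hh j
    rw [← hΦapply, RingEquiv.apply_symm_apply] at hh'
    exact hh'
  · refine Ideal.map_le_iff_le_comap.2 fun c hc => ?_
    rw [Ideal.mem_comap] at hc ⊢
    have hC : Polynomial.C c = Φ (rename Fin.castSucc c) := by
      rw [hΦapply, optionEquivLeft_rename_rename_castSucc]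
    rw [hC]
    exact Ideal.mem_map_of_mem _ hc

/-- **Cylinders drop the dimension by one.**  If `B ⊆ F^{d+1}` has period `e_last` then
`dim F[x]/I(B) = dim F[x']/(I(B) ∩ F[x']) + 1`. [folklore] -/
theorem ringKrullDim_quotient_eq_of_isPeriodVec [Infinite F]
    (hper : IsPeriodVec F B (Pi.single (Fin.last d) 1)) :
    ringKrullDim (MvPolynomial (Fin (d + 1)) F ⧸ vanishingIdeal F B) =
      ringKrullDim (MvPolynomial (Fin d) F ⧸
        ((vanishingIdeal F B).comap (rename (R := F) (Fin.castSucc (n := d)) :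
          MvPolynomial (Fin d) F →+* MvPolynomial (Fin (d + 1)) F))) + 1 := by
  set Φ := ((MvPolynomial.renameEquiv F (finSuccEquivLast (n := d))).trans
    (MvPolynomial.optionEquivLeft F (Fin d))).toRingEquiv with hΦ
  set J : Ideal (MvPolynomial (Fin d) F) := (vanishingIdeal F B).comap
    (rename (R := F) (Fin.castSucc (n := d)) : MvPolynomial (Fin d) F →+* MvPolynomial (Fin (d + 1)) F)
    with hJ
  -- `F[x]/I(B) ≃ F[x'][X]/J^e ≃ (F[x']/J)[X]`
  have e₁ : (MvPolynomial (Fin (d + 1)) F ⧸ vanishingIdeal F B) ≃+*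
      (Polynomial (MvPolynomial (Fin d) F) ⧸
        Ideal.map (Polynomial.C : MvPolynomial (Fin d) F →+* _) J) :=
    Ideal.quotientEquiv _ _ Φ (map_vanishingIdeal_eq_map_C hper).symm
  have e₂ := (Ideal.polynomialQuotientEquivQuotientPolynomial J).symm
  rw [ringKrullDim_eq_of_ringEquiv
      (S := Polynomial (MvPolynomial (Fin d) F) ⧸ Ideal.map (Polynomial.C : MvPolynomial (Fin d) F →+* _) J) e₁,
    ringKrullDim_eq_of_ringEquiv (S := Polynomial (MvPolynomial (Fin d) F ⧸ J)) e₂,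
    Polynomial.ringKrullDim_of_isNoetherianRing]

end Cylinder

end Summit.Schanuel.Schanuel.Theorems
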